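import Summits.ResolutionOfSingularities.ResolutionOfSingularities.Theorems.FrobeniusClosingPatchingRelPerfectTwoPlanesLevelTwoS
import Summits.ResolutionOfSingularities.ResolutionOfSingularities.Theorems.FrobeniusClosingPatchingRelPerfectLetterTower
import HarnessLib

/-!
# Crux `PatchingRelPerfect` (stmt-ResolutionOfSingularities-16161), chain w52 — the rank-two member
# `f = x₀x₁ + x₂³`: the POINT step on the `s`-chart of `B₃` — chart ideals (level three, any ring)

[OURS · L1 W5.2 · rung, design note NEXT-two-planes-cube.md Addenda 9–12, kit j286610/j288133]
Abstract setting of the `A₂` spot: a ring `C` (it will be the `s`-chart `C₀` of `Bl_{(u,e₀)} B₃`)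
with four elements `t, p, a, b` (there: `w₀, s, e₁, e₂`), the point `q = V(t, p, a, b)`, the
`A₂` surface `Z″ = V(t, h″)`, `h″ = p a + b³`, inside `E = V(t)`, and the plane avatar
`P_π = (t) + (p, a, b)²`.  After the twist the companion reads `𝔪_q · P_π · (h″, t)²` on `C`;
blowing up `𝔪_q = (t, p, a, b)` (family `qq = (t, p, a, b)`, charts `C_i`, exceptional `w`,
generators `e′_j`, `u′ = e′₀` the strict transform of `E`):

* chart `t` (`i = 0`): `P_π ↦ (w)`, `(h″, t) ↦ (w)` — everything Cartier (`map_K_zero`);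
* charts `p, a, b` (`i = k+1`): `P_π ↦ (w)(u′, w)` — THE PLANE `E′ ∩ E_q`; `(h″, t) ↦ (w)(u′, w g)`
  with `g` the strict transform of `Z″` (`e′₂ + w e′₃³`, `e′₁ + w e′₃³`, `e′₁e′₂ + w`: graphs), so
  the companion becomes `(w)³ · (u′, w)(u′, w g)(u′, w g)` = the letter flag of the word `(w, g, 1)`
  (`map_K_succ`, `tp_flag_wg`).

Pure ideal bookkeeping over any commutative ring; nothing here is a statement of the manuscript
under review.

## References

* The Stacks Project, Tags 0804, 080B. [StacksProject]
-/

-- `Summit.<Summit>.<Sub>.Theorems` with `Sub = Summit` (single-conjunct summit, D-0017)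
set_option linter.dupNamespace false

noncomputable section

open CategoryTheory CategoryTheory.Limits AlgebraicGeometry Literature.AlgebraicGeometry.Resolution
open IsLocalRing

namespace Summit.ResolutionOfSingularities.ResolutionOfSingularities.Theorems

namespace TwoPlanesRung

open ConeRung

universe u

/-! ## Generic algebra -/

/-- The flag of the word `(ℓ, o, 1)`: `∏_{s<3} (c, L₀⋯L_s) = (c, ℓ)(c, ℓ o)(c, ℓ o)`. [folklore] -/
theorem tp_flag_wg {B : Type*} [CommRing B] (c ℓ o : B) :
    ∏ s ∈ Finset.range 3, Ideal.span {c, ∏ r ∈ Finset.range (s + 1), [ℓ, o, 1].getD r 1} =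
      Ideal.span {c, ℓ} * Ideal.span {c, ℓ * o} * Ideal.span {c, ℓ * o} := by
  have h : ∏ s ∈ Finset.range 3, Ideal.span {c, ∏ r ∈ Finset.range (s + 1), [ℓ, o, 1].getD r 1} =
      Ideal.span {c, ℓ} * Ideal.span {c, ℓ * o} * Ideal.span {c, ℓ * o * 1} := by
    simp only [Finset.prod_range_succ, Finset.prod_range_zero, one_mul]
    rfl
  rw [h, mul_one]

/-- Letters of the word `(ℓ, o, 1)`. [folklore] -/
theorem tp_letters_wg {B : Type*} [One B] (ℓ o : B) (r : ℕ) :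
    [ℓ, o, 1].getD r 1 = ℓ ∨ [ℓ, o, 1].getD r 1 = o ∨ [ℓ, o, 1].getD r 1 = 1 := by
  rcases r with _ | _ | _ | r <;> simp

/-- Reordering: `W X · (W Y)² = W³ · (X Y Y)`. [folklore] -/
theorem tp_point_product {B : Type*} [CommRing B] (W X Y : Ideal B) :
    W * X * (W * Y) ^ 2 = W ^ 3 * (X * Y * Y) := by
  ring

/-- `(w² g, w u) = (w) · (u, w g)`. [folklore] -/
theorem span_pair_sq_mul {B : Type*} [CommRing B] (w g v : B) :
    Ideal.span {w ^ 2 * g, w * v} = Ideal.span {w} * Ideal.span {v, w * g} := by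
  rw [ConeRung.span_singleton_mul_span_pair, Ideal.span_pair_comm, sq, mul_assoc]

section PointCharts

variable {C : Type u} [CommRing C] (t p a b : C)

local notation3 "qq" => (Fin.cons t ![p, a, b] : Fin 4 → C)
local notation3 "MQ" => Ideal.span (Set.range (Fin.cons t ![p, a, b] : Fin 4 → C))
local notation3 "Ppi" => Ideal.span {t} ⊔ Ideal.span {p, a, b} ^ 2
local notation3 "hh" => p * a + b ^ 3
local notation3 "ψ[" i "]" => chartBase (Fin.cons t ![p, a, b] : Fin 4 → C) i
local notation3 "w[" i "]" => chartBase (Fin.cons t ![p, a, b] : Fin 4 → C) i ((Fin.cons t ![p, a, b] : Fin 4 → C) i)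
local notation3 "e[" i "," j "]" => chartGen (Fin.cons t ![p, a, b] : Fin 4 → C) i j

/-- `ψ_i(t) = w e′₀`, `ψ_i(p) = w e′₁`, `ψ_i(a) = w e′₂`, `ψ_i(b) = w e′₃`. [cite: StacksProject, Tag 0804] -/
theorem chartBase_tpab (i : Fin 4) :
    ψ[i] t = w[i] * e[i, 0] ∧ ψ[i] p = w[i] * e[i, 1] ∧ ψ[i] a = w[i] * e[i, 2] ∧ ψ[i] b = w[i] * e[i, 3] :=
  ⟨reesChartBase_apply_eq_mul_chartGen qq i 0, reesChartBase_apply_eq_mul_chartGen qq i 1,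
    reesChartBase_apply_eq_mul_chartGen qq i 2, reesChartBase_apply_eq_mul_chartGen qq i 3⟩

/-- `h″ ∈ 𝔪_q`. [folklore] -/
theorem hh_mem_MQ : hh ∈ MQ := by
  have ha : a ∈ MQ := Ideal.subset_span (Set.mem_range_self (f := qq) (2 : Fin 4))
  have hb : b ∈ MQ := Ideal.subset_span (Set.mem_range_self (f := qq) (3 : Fin 4))
  exact Ideal.add_mem _ (Ideal.mul_mem_left _ _ ha) (Ideal.pow_mem_of_mem _ hb 3 (by norm_num))

/-- `𝔪_q C_i = (w)`. [cite: StacksProject, Tag 0804] -/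
theorem map_MQ (i : Fin 4) : (MQ).map ψ[i] = Ideal.span {w[i]} :=
  map_reesChartBase_eq (qq i) (Ideal.mem_span_range_self (f := qq) (x := i))

/-- `(p, a, b) C_i ≤ (w)`. [cite: StacksProject, Tag 0804] -/
theorem map_span_pab_le (i : Fin 4) : (Ideal.span {p, a, b}).map ψ[i] ≤ Ideal.span {w[i]} := by
  rw [← map_MQ t p a b i]
  refine Ideal.map_mono (Ideal.span_le.mpr ?_)
  rintro c (rfl | rfl | rfl)
  · exact Ideal.subset_span ⟨1, rfl⟩
  · exact Ideal.subset_span ⟨2, rfl⟩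
  · exact Ideal.subset_span ⟨3, rfl⟩

/-- On the chart of `p`, `a` or `b`: `(p, a, b) C_{k+1} = (w)`. [cite: StacksProject, Tag 0804] -/
theorem map_span_pab_succ (k : Fin 3) : (Ideal.span {p, a, b}).map ψ[Fin.succ k] = Ideal.span {w[Fin.succ k]} := by
  refine le_antisymm (map_span_pab_le t p a b _) ?_
  rw [Ideal.span_singleton_le_iff_mem]
  refine Ideal.mem_map_of_mem _ (Ideal.subset_span ?_)
  rw [Fin.cons_succ]
  fin_cases k <;> simp

/-! ### The chart of `t` (everything Cartier) -/

/-- `P_π C₀ = (w)`. [cite: StacksProject, Tag 080B] -/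
theorem map_Ppi_zero : (Ppi).map ψ[0] = Ideal.span {w[0]} := by
  have ht : (Ideal.span {t}).map ψ[0] = Ideal.span {w[0]} := by
    rw [Ideal.map_span, Set.image_singleton]; rfl
  rw [Ideal.map_sup, ht, Ideal.map_pow]
  exact le_antisymm (sup_le le_rfl ((Ideal.pow_right_mono (map_span_pab_le t p a b 0) 2).trans
    (Ideal.pow_le_self two_ne_zero))) le_sup_left

/-- `(h″, t) C₀ = (w)`. [cite: StacksProject, Tag 080B] -/
theorem map_span_hh_t_zero : (Ideal.span {hh, t}).map ψ[0] = Ideal.span {w[0]} := by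
  rw [Ideal.map_span, Set.image_pair]
  refine le_antisymm (Ideal.span_le.mpr (Set.pair_subset_iff.mpr ⟨?_, Ideal.mem_span_singleton_self _⟩))
    (Ideal.span_mono (Set.subset_insert _ _ |>.trans' (Set.singleton_subset_iff.mpr rfl)))
  rw [SetLike.mem_coe, ← map_MQ t p a b 0]
  exact Ideal.mem_map_of_mem _ (hh_mem_MQ t p a b)

/-- **Chart of `t`: `P_π · (h″, t)² ↦ (w³)`.** [cite: StacksProject, Tag 080B] -/
theorem map_K_zero : (Ppi * Ideal.span {hh, t} ^ 2).map ψ[0] = Ideal.span {w[0] ^ 3} := by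
  rw [Ideal.map_mul, Ideal.map_pow, map_Ppi_zero, map_span_hh_t_zero, ← pow_succ', Ideal.span_singleton_pow]

/-! ### The charts of `p`, `a`, `b` -/

/-- `P_π C_{k+1} = (w)·(u′, w)` — the plane `E′ ∩ E_q`. [cite: StacksProject, Tag 080B] -/
theorem map_Ppi_succ (k : Fin 3) :
    (Ppi).map ψ[Fin.succ k] = Ideal.span {w[Fin.succ k]} * Ideal.span {e[Fin.succ k, 0], w[Fin.succ k]} := by
  have ht : (Ideal.span {t}).map ψ[Fin.succ k] = Ideal.span {w[Fin.succ k]} * Ideal.span {e[Fin.succ k, 0]} := by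
    rw [Ideal.map_span, Set.image_singleton, Ideal.span_singleton_mul_span_singleton]
    exact congrArg (fun c => Ideal.span {c}) (chartBase_tpab t p a b (Fin.succ k)).1
  rw [Ideal.map_sup, ht, Ideal.map_pow, map_span_pab_succ, Ideal.span_insert, Ideal.mul_sup, sq]

/-- `(h″, t) C_{k+1} = (w)·(u′, w g)` when `ψ(h″) = w² g`. [cite: StacksProject, Tag 080B] -/
theorem map_span_hh_t_succ (k : Fin 3) (g : chartRing qq (Fin.succ k))
    (hg : ψ[Fin.succ k] hh = w[Fin.succ k] ^ 2 * g) :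
    (Ideal.span {hh, t}).map ψ[Fin.succ k] =
      Ideal.span {w[Fin.succ k]} * Ideal.span {e[Fin.succ k, 0], w[Fin.succ k] * g} := by
  rw [Ideal.map_span, Set.image_pair, hg, (chartBase_tpab t p a b (Fin.succ k)).1]
  exact span_pair_sq_mul _ _ _

/-- **Charts of `p, a, b`: `P_π · (h″, t)² ↦ (w³) · (u′, w)(u′, w g)(u′, w g)`** — the letter flag of
the word `(w, g, 1)` on `c = u′`. [cite: StacksProject, Tag 080B] -/
theorem map_K_succ (k : Fin 3) (g : chartRing qq (Fin.succ k))
    (hg : ψ[Fin.succ k] hh = w[Fin.succ k] ^ 2 * g) :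
    (Ppi * Ideal.span {hh, t} ^ 2).map ψ[Fin.succ k] = Ideal.span {w[Fin.succ k] ^ 3} *
      ∏ s ∈ Finset.range 3, Ideal.span {e[Fin.succ k, 0],
        ∏ r ∈ Finset.range (s + 1), [w[Fin.succ k], g, 1].getD r 1} := by
  rw [Ideal.map_mul, Ideal.map_pow, map_Ppi_succ, map_span_hh_t_succ t p a b k g hg, tp_point_product,
    Ideal.span_singleton_pow]
  exact congrArg (Ideal.span {w[Fin.succ k] ^ 3} * ·) (tp_flag_wg _ _ _).symm

/-! ### The strict transform `g` of the `A₂` surface on the three charts -/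

/-- Chart of `p`: `ψ(h″) = w² (e′₂ + w e′₃³)`. [folklore] -/
theorem chartBase_hh_one : ψ[1] hh = w[1] ^ 2 * (e[1, 2] + w[1] * e[1, 3] ^ 3) := by
  obtain ⟨-, hp, ha, hb⟩ := chartBase_tpab t p a b 1
  have h11 : e[1, 1] = 1 := chartGen_self qq 1
  rw [map_add, map_mul, map_pow, hp, ha, hb, h11]
  ring

/-- Chart of `a`: `ψ(h″) = w² (e′₁ + w e′₃³)`. [folklore] -/
theorem chartBase_hh_two : ψ[2] hh = w[2] ^ 2 * (e[2, 1] + w[2] * e[2, 3] ^ 3) := by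
  obtain ⟨-, hp, ha, hb⟩ := chartBase_tpab t p a b 2
  have h22 : e[2, 2] = 1 := chartGen_self qq 2
  rw [map_add, map_mul, map_pow, hp, ha, hb, h22]
  ring

/-- Chart of `b`: `ψ(h″) = w² (e′₁ e′₂ + w)`. [folklore] -/
theorem chartBase_hh_three : ψ[3] hh = w[3] ^ 2 * (e[3, 1] * e[3, 2] + w[3]) := by
  obtain ⟨-, hp, ha, hb⟩ := chartBase_tpab t p a b 3
  have h33 : e[3, 3] = 1 := chartGen_self qq 3
  rw [map_add, map_mul, map_pow, hp, ha, hb, h33]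
  ring

end PointCharts

end TwoPlanesRung

end Summit.ResolutionOfSingularities.ResolutionOfSingularities.Theorems

end
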